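import Literature.NumberTheory.EllipticCurves.CMSigmaSqIntegralityProofs
import HarnessLib

/-!
# Calculus along a formal isogeny `T : V̂ → V̂'` (`log_{V'}(T) = π·log_V`) and rigidity, for the squared `2`-isogeny
# functional equation of the Mazur–Tate sigma function (crux C3′, stub `stub_sigmaSqTwo`; route-independent)

Cell `bsd-f1-sign2`, WIDTH-5 attach seat `bsd-line-att-p3` g8 (`--supports stmt-BirchSwinnertonDyer-23008`). THEOREMS ONLY.
BSD is not proved by any of this. TWO-CURVE versions of the (file-private) §B–§C lemmas of the tree's
`CMSigmaSqIntegralityProofs.lean` (Perrin-Riou's CM argument, where `V' = V` and `T = [ϖ]`), for a pair of Weierstrass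
curves `V, V'` over `ℚ_p` and a series `T ∈ zℚ_p⟦z⟧` with `log_{V'}(T) = π·log_V` (a homomorphism of formal groups
`V̂ → V̂'` multiplying the invariant differential by `π`; e.g. the parameter `ψ*z'` of an isogeny `ψ : V → V'` with
`ψ*ω' = πω`). Used by `…SigmaSqTwoIsogenyFE.lean` (the squared functional equation `z²·σ'(T)² = π²σ⁴(X − ez²)` of the
quotient by the canonical subgroup at `p = 2`, step S5 of the discharge plan `Cruxes/BSDOfMainConjectureRankOneAtTwo/SIGMASQ-AT-TWO-att-p3.md`).

* §1 `formalInvDiff_subst_mul_derivative_two` (`ω'(T)·T' = πω`), `coeff_one_of_formalLog_subst_two` (`[z¹]T = π`),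
  `two_mul_coeff_two_formalLog` (`2[z²]log = a₁`), `two_mul_coeff_two_of_formalLog_subst_two`
  (`2[z²]T = a₁π − a₁'π²`), `logDeriv₂Num_subst_two` (`N_V(h∘T) = π²·(N_{V'}h)∘T`), `coeff_sigma_subst_two`
  (`σ'∘T = πz + (a₁π/2)z² + ⋯` for `σ'` normalised odd on `V'`).
* §2 `logDeriv₂Num_X_sq_ratio`, `X_sq_mul_logDeriv₂Num_formalXMulSq_sub` (ratio datum of `A = X − ez²` at a `2`-torsion
  abscissa: `z²N(A) = (2κA + 2A² − 2tz⁴)A`, `2t = 6e² + b₂e + b₄`) — verbatim from the CM file, made public.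
* §3 rigidity: `eq_C_of_formalInvariantDerivation_eq_zero'`, `eq_one_of_logDeriv₂Num_eq_zero`, `eq_of_logDeriv₂Num_X_pow_mul_eq`.

## Sources
* B. Perrin-Riou, Mém. SMF 17 (1984), Ch. III §1.2. [cite: Perrinriou1984, Ch. III §1.2 Lemme 2]
* C. Blakestad, D. Grant, J. Number Theory 249 (2023), §2.2 (chain rule for `D`), Prop. 14 (Wronskian). [cite: BlakestadGrant2023, §2.2]
* B. Mazur, J. Tate, Duke Math. J. 62 (1991), §3. [cite: MazurTate1991, Thm. 3.1]
* J. Vélu, C. R. Acad. Sci. Paris 273 (1971). [cite: SilvermanAEC2009, III.4]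
-/

noncomputable section

set_option linter.dupNamespace false
set_option autoImplicit false

open scoped Classical
open PowerSeries WeierstrassCurve Literature.NumberTheory.EllipticCurves

namespace Summit.BirchSwinnertonDyer.BirchSwinnertonDyer.Theorems.AlignedTransportAtTwoSigmaSqTwo

variable {p : ℕ} [Fact p.Prime] (V V' : WeierstrassCurve ℚ_[p])

/-! ## §1 Calculus along `T` with `log_{V'}(T) = π·log_V` -/

/-- From `log_{V'}(T) = π·log_V` (and `T(0) = 0`): `ω'(T)·T' = π·ω` — `T` pulls the invariant differential of `V'`
back to `π` times that of `V`. [cite: SilvermanAEC2009, IV.4–IV.5] -/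
theorem formalInvDiff_subst_mul_derivative_two {T : ℚ_[p]⟦X⟧} {π : ℚ_[p]}
    (hT0 : constantCoeff T = 0) (hlog : V'.formalLog.subst T = C π * V.formalLog) :
    V'.formalInvDiff.subst T * d⁄dX ℚ_[p] T = C π * V.formalInvDiff := by
  have hs : HasSubst T := HasSubst.of_constantCoeff_zero' hT0
  have h := congrArg (d⁄dX ℚ_[p]) hlog
  rw [derivative_subst ℚ_[p] hs, derivative_formalLog, Derivation.leibniz, derivative_C, smul_zero,
    add_zero, smul_eq_mul, derivative_formalLog] at h
  rw [formalInvDiff_eq_formalOmega, formalInvDiff_eq_formalOmega]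
  exact h

/-- The linear coefficient of `T`: `[z¹]T = π`. [folklore] -/
theorem coeff_one_of_formalLog_subst_two {T : ℚ_[p]⟦X⟧} {π : ℚ_[p]}
    (hT0 : constantCoeff T = 0) (hlog : V'.formalLog.subst T = C π * V.formalLog) : coeff 1 T = π := by
  have h := congrArg (coeff 1) hlog
  rw [coeff_subst_eq_sum_range hT0, Finset.sum_range_succ, Finset.sum_range_succ, Finset.sum_range_zero,
    zero_add, pow_zero, coeff_one, if_neg one_ne_zero, zero_mul, zero_add, pow_one,
    coeff_one_formalLog, mul_one, coeff_C_mul, coeff_one_formalLog, mul_one] at h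
  exact h

/-- `2·[z²] log_V = a₁`. [cite: SilvermanAEC2009, IV.1 and IV.4] -/
theorem two_mul_coeff_two_formalLog : 2 * coeff 2 V.formalLog = V.a₁ := by
  have h := congrArg (coeff 1) V.derivative_formalLog
  rw [coeff_derivative, ← formalInvDiff_eq_formalOmega, coeff_one_formalInvDiff] at h
  have e : coeff (1 + 1) V.formalLog * ((1 : ℕ) + 1 : ℚ_[p]) = V.a₁ := by exact_mod_cast h
  norm_num at e
  linear_combination e

/-- `[z²](T²) = ([z¹]T)²` for `T(0) = 0`. [folklore] -/
theorem coeff_two_sq_of_constantCoeff_eq_zero {T : ℚ_[p]⟦X⟧} (hT0 : constantCoeff T = 0) :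
    coeff 2 (T ^ 2) = coeff 1 T ^ 2 := by
  have h := Literature.RingTheory.FormalGroups.coeff_pow_mul_of_constantCoeff_eq_zero hT0 1 2
  rwa [mul_one, map_one, mul_one] at h

/-- The quadratic coefficient of `T`: **`2·[z²]T = a₁π − a₁'π²`** (`a₁` of `V`, `a₁'` of `V'`). [folklore] -/
theorem two_mul_coeff_two_of_formalLog_subst_two {T : ℚ_[p]⟦X⟧} {π : ℚ_[p]}
    (hT0 : constantCoeff T = 0) (hlog : V'.formalLog.subst T = C π * V.formalLog) :
    2 * coeff 2 T = V.a₁ * π - V'.a₁ * π ^ 2 := by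
  have h1 := coeff_one_of_formalLog_subst_two V V' hT0 hlog
  have hℓ := two_mul_coeff_two_formalLog V
  have hℓ' := two_mul_coeff_two_formalLog V'
  have h := congrArg (coeff 2) hlog
  rw [coeff_subst_eq_sum_range hT0, Finset.sum_range_succ, Finset.sum_range_succ, Finset.sum_range_succ,
    Finset.sum_range_zero, zero_add, pow_zero, coeff_one, if_neg two_ne_zero, zero_mul, zero_add, pow_one,
    coeff_one_formalLog, mul_one, coeff_C_mul, coeff_two_sq_of_constantCoeff_eq_zero hT0, h1] at h
  linear_combination 2 * h + π * hℓ - π ^ 2 * hℓ'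

/-- **`N_V(h ∘ T) = π² · (N_{V'} h) ∘ T`** for `N(f) = f·D²f − (Df)²` (`D` the invariant derivation of the respective
curve), when `log_{V'}(T) = π·log_V` (chain rule `D_V(h∘T) = π·(D_{V'}h)∘T`). [cite: BlakestadGrant2023, §2.2] -/
theorem logDeriv₂Num_subst_two {T : ℚ_[p]⟦X⟧} {π : ℚ_[p]} (hT0 : constantCoeff T = 0)
    (hlog : V'.formalLog.subst T = C π * V.formalLog) (h : ℚ_[p]⟦X⟧) :
    logDeriv₂Num V.formalInvariantDerivation (h.subst T) =
      C π ^ 2 * (logDeriv₂Num V'.formalInvariantDerivation h).subst T := by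
  have hs : HasSubst T := HasSubst.of_constantCoeff_zero' hT0
  have hTω := formalInvDiff_subst_mul_derivative_two V V' hT0 hlog
  have hc : ∀ g : ℚ_[p]⟦X⟧, V.formalInvariantDerivation (g.subst T) =
      C π * (V'.formalInvariantDerivation g).subst T :=
    fun g => V.formalInvariantDerivation_subst_of_formalInvDiff_subst hT0 hTω g
  rw [logDeriv₂Num_def, logDeriv₂Num_def, hc, V.formalInvariantDerivation_C_mul, hc, subst_sub hs,
    subst_mul hs, subst_pow hs]
  ring

/-- `[z⁰](σ' ∘ T) = 0`, `[z¹](σ' ∘ T) = π` and **`2[z²](σ' ∘ T) = a₁·π`** (`a₁` of the SOURCE `V`) for a normalised odd `σ'`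
on `V'` (`2[z²]σ' = a₁'`) and `T` with `log_{V'}(T) = π log_V`. [folklore] -/
theorem coeff_sigma_subst_two {σ' T : ℚ_[p]⟦X⟧} {π : ℚ_[p]} (hσ0 : constantCoeff σ' = 0)
    (hσ1 : coeff 1 σ' = 1) (hodd : V'.IsFormallyOdd σ') (hT0 : constantCoeff T = 0)
    (hlog : V'.formalLog.subst T = C π * V.formalLog) :
    constantCoeff (σ'.subst T) = 0 ∧ coeff 1 (σ'.subst T) = π ∧ 2 * coeff 2 (σ'.subst T) = V.a₁ * π := by
  have h1 := coeff_one_of_formalLog_subst_two V V' hT0 hlog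
  have h2 := two_mul_coeff_two_of_formalLog_subst_two V V' hT0 hlog
  have hσ2 := V'.two_mul_coeff_two_of_isFormallyOdd hodd hσ0 hσ1
  refine ⟨?_, ?_, ?_⟩
  · rw [Literature.RingTheory.FormalGroups.constantCoeff_subst_of_constantCoeff_eq_zero hT0, hσ0]
  · rw [coeff_subst_eq_sum_range hT0, Finset.sum_range_succ, Finset.sum_range_succ, Finset.sum_range_zero,
      zero_add, pow_zero, coeff_one, if_neg one_ne_zero, zero_mul, zero_add, pow_one, h1, hσ1, mul_one]
  · rw [coeff_subst_eq_sum_range hT0, Finset.sum_range_succ, Finset.sum_range_succ, Finset.sum_range_succ,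
      Finset.sum_range_zero, zero_add, pow_zero, coeff_one, if_neg two_ne_zero, zero_mul, zero_add, pow_one,
      hσ1, mul_one, coeff_two_sq_of_constantCoeff_eq_zero hT0, h1]
    linear_combination h2 + π ^ 2 * hσ2

/-- `(C r)(T) = C r`. [folklore] -/
theorem C_subst_eq {T : ℚ_[p]⟦X⟧} (r : ℚ_[p]) : (C r : ℚ_[p]⟦X⟧).subst T = C r := by
  rw [subst_C]; rfl

/-! ## §2 Ratio data (verbatim from the CM file, made public) -/

/-- `N(z²)·z² = 2κ·(z²)²`, `κ = z·Dη − η²`. [folklore] -/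
theorem logDeriv₂Num_X_sq_ratio :
    logDeriv₂Num V.formalInvariantDerivation (X ^ 2) * X ^ 2 =
      (2 * (X * V.formalInvariantDerivation V.formalEta - V.formalEta ^ 2)) * (X ^ 2) ^ 2 := by
  rw [logDeriv₂Num_sq, logDeriv₂Num_def, formalInvariantDerivation_X]
  ring

/-- **Ratio datum of `A = X − e z²` at a `2`-torsion abscissa `e`** (`4e³ + b₂e² + 2b₄e + b₆ = 0`):
`z²·N(A) = (2κ·A + 2A² − 2t z⁴)·A`, `2t = 6e² + b₂e + b₄` — the cleared form of `−(log(x − e))'' = −2(x − e) + 2t/(x − e)`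
(Vélu's `2`-isogeny with kernel `{O, (e, ·)}`). Verbatim from `CMSigmaSqIntegralityProofs` (private there).
[cite: SilvermanAEC2009, III.4] -/
theorem X_sq_mul_logDeriv₂Num_formalXMulSq_sub {e t : ℚ_[p]}
    (he : 4 * e ^ 3 + V.b₂ * e ^ 2 + 2 * V.b₄ * e + V.b₆ = 0) (ht : 2 * t = 6 * e ^ 2 + V.b₂ * e + V.b₄) :
    X ^ 2 * logDeriv₂Num V.formalInvariantDerivation (V.formalXMulSq - C e * X ^ 2) =
      (2 * (X * V.formalInvariantDerivation V.formalEta - V.formalEta ^ 2) * (V.formalXMulSq - C e * X ^ 2) +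
        2 * (V.formalXMulSq - C e * X ^ 2) ^ 2 - 2 * C t * X ^ 4) * (V.formalXMulSq - C e * X ^ 2) := by
  have hDX : V.formalInvariantDerivation X = V.formalEta := V.formalInvariantDerivation_X
  have hD2 : V.formalInvariantDerivation (2 : ℚ_[p]⟦X⟧) = 0 := Derivation.map_natCast _ 2
  have hF1 := V.X_mul_formalInvariantDerivation_formalXMulSq
  have hF2 := V.X_mul_formalInvariantDerivation_formalYTilde
  have hF3 := V.formalYTilde_sq
  set Yt := (C V.a₁ * X - 2) * V.formalXMulSq + C V.a₃ * X ^ 3 with hYt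
  set Xs := V.formalXMulSq with hXs
  set η := V.formalEta with hη
  have hQ0 := congrArg V.formalInvariantDerivation hF1
  simp only [Derivation.leibniz, map_add, hDX, hD2, smul_eq_mul] at hQ0
  have hQ : X ^ 2 * V.formalInvariantDerivation (V.formalInvariantDerivation Xs) =
      2 * X * V.formalInvariantDerivation η * Xs + 2 * η ^ 2 * Xs + 4 * η * Yt + 6 * Xs ^ 2 +
        C V.b₂ * X ^ 2 * Xs + C V.b₄ * X ^ 4 := by
    linear_combination X * hQ0 + η * hF1 + hF2
  have heC : 4 * (C e : ℚ_[p]⟦X⟧) ^ 3 + C V.b₂ * C e ^ 2 + 2 * C V.b₄ * C e + C V.b₆ = 0 := by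
    have := congrArg (C (R := ℚ_[p])) he
    simpa only [map_add, map_mul, map_pow, map_ofNat, map_zero] using this
  have htC : 2 * (C t : ℚ_[p]⟦X⟧) = 6 * C e ^ 2 + C V.b₂ * C e + C V.b₄ := by
    have := congrArg (C (R := ℚ_[p])) ht
    simpa only [map_add, map_mul, map_pow, map_ofNat] using this
  have hDA : V.formalInvariantDerivation (Xs - C e * X ^ 2) =
      V.formalInvariantDerivation Xs - 2 * C e * X * η := by
    rw [map_sub, V.formalInvariantDerivation_C_mul, Derivation.leibniz_pow, hDX]
    simp only [nsmul_eq_mul, smul_eq_mul, Nat.cast_ofNat, Nat.add_one_sub_one, pow_one]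
    ring
  have hDDA : V.formalInvariantDerivation (V.formalInvariantDerivation (Xs - C e * X ^ 2)) =
      V.formalInvariantDerivation (V.formalInvariantDerivation Xs) -
        2 * C e * (η * η + X * V.formalInvariantDerivation η) := by
    rw [hDA, map_sub]
    have : V.formalInvariantDerivation (2 * C e * X * η) =
        2 * C e * (η * η + X * V.formalInvariantDerivation η) := by
      simp only [Derivation.leibniz, hDX, hD2, formalInvariantDerivation_C, smul_eq_mul]
      ring
    rw [this]
  rw [logDeriv₂Num_def, hDDA, hDA]
  linear_combination (-(X * V.formalInvariantDerivation Xs) - (2 * η * Xs + Yt) + 4 * C e * X ^ 2 * η) * hF1 +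
    (Xs - C e * X ^ 2) * hQ + (-1 : ℚ_[p]⟦X⟧) * hF3 + (-X ^ 6) * heC + (X ^ 4 * (Xs - C e * X ^ 2)) * htC

/-! ## §3 Rigidity (verbatim from the CM file, made public) -/

/-- `D`-constants are constants: `Df = 0 ⇒ f = f(0)`. [folklore] -/
theorem eq_C_of_formalInvariantDerivation_eq_zero' {f : ℚ_[p]⟦X⟧}
    (h : V.formalInvariantDerivation f = 0) : f = C (constantCoeff f) := by
  rw [formalInvariantDerivation_apply] at h
  have h' : d⁄dX ℚ_[p] f = 0 := (V.isUnit_formalEta.mul_right_eq_zero).mp h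
  ext n
  rcases n with _ | n
  · simp
  · rw [coeff_C, if_neg (Nat.succ_ne_zero n)]
    have e := congrArg (coeff n) h'
    rw [coeff_derivative, map_zero] at e
    exact (mul_eq_zero.mp e).resolve_right (by exact_mod_cast Nat.succ_ne_zero n)

/-- **Rigidity.** `N(q) = 0`, `q(0) = 1`, `[z¹]q = 0` ⇒ `q = 1`. [cite: MazurTate1991, Thm. 3.1] -/
theorem eq_one_of_logDeriv₂Num_eq_zero {q : ℚ_[p]⟦X⟧} (hq0 : constantCoeff q = 1)
    (hq1 : coeff 1 q = 0) (hN : logDeriv₂Num V.formalInvariantDerivation q = 0) : q = 1 := by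
  set D := V.formalInvariantDerivation with hD
  have hqi : q * invOfUnit q 1 = 1 := mul_invOfUnit q 1 (by rw [hq0, Units.val_one])
  set iq := invOfUnit q 1 with hiq
  have hqne : q ≠ 0 := fun h0 => by rw [h0, map_zero] at hq0; exact zero_ne_one hq0
  have hDi : q * D iq + iq * D q = 0 := by
    have e := congrArg D hqi
    rwa [Derivation.leibniz, smul_eq_mul, smul_eq_mul, Derivation.map_one_eq_zero] at e
  set L := D q * iq with hL
  have hDL : D L = 0 := by
    have e : q ^ 2 * D L = 0 := by
      rw [logDeriv₂Num_def] at hN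
      have : q ^ 2 * D L = (q * D (D q) - D q ^ 2) * (q * iq) + q * D q * (q * D iq + iq * D q) := by
        rw [hL, Derivation.leibniz, smul_eq_mul, smul_eq_mul]; ring
      rw [this, hN, hDi, zero_mul, mul_zero, add_zero]
    exact (mul_eq_zero.mp e).resolve_left (pow_ne_zero _ hqne)
  have hL0 : constantCoeff L = 0 := by
    rw [hL, map_mul, hD, formalInvariantDerivation_apply, map_mul, constantCoeff_formalEta, one_mul,
      ← coeff_zero_eq_constantCoeff_apply (d⁄dX ℚ_[p] q), coeff_derivative, zero_add, hq1]
    simp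
  have hLz : L = 0 := by
    have e := eq_C_of_formalInvariantDerivation_eq_zero' V hDL
    rwa [hL0, map_zero] at e
  have hDq : D q = 0 := by
    calc D q = D q * (q * iq) := by rw [hqi, mul_one]
      _ = L * q := by rw [hL]; ring
      _ = 0 := by rw [hLz, zero_mul]
  have e := eq_C_of_formalInvariantDerivation_eq_zero' V hDq
  rw [hq0, map_one] at e
  exact e

/-- **Equal second logarithmic derivatives and equal `2`-jets after a common power of `z` force equality.**
[cite: BlakestadGrant2023, Prop. 14] -/
theorem eq_of_logDeriv₂Num_X_pow_mul_eq {f₀ g₀ : ℚ_[p]⟦X⟧} (k : ℕ)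
    (h0 : constantCoeff f₀ = constantCoeff g₀) (hne : constantCoeff g₀ ≠ 0) (h1 : coeff 1 f₀ = coeff 1 g₀)
    (hN : logDeriv₂Num V.formalInvariantDerivation (X ^ k * f₀) * (X ^ k * g₀) ^ 2 =
      logDeriv₂Num V.formalInvariantDerivation (X ^ k * g₀) * (X ^ k * f₀) ^ 2) : f₀ = g₀ := by
  set D := V.formalInvariantDerivation with hD
  have hg0ne : g₀ ≠ 0 := fun h => by rw [h, map_zero] at hne; exact hne rfl
  have hi : logDeriv₂Num D f₀ * g₀ ^ 2 = logDeriv₂Num D g₀ * f₀ ^ 2 := by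
    have e : X ^ (4 * k) * (logDeriv₂Num D f₀ * g₀ ^ 2 - logDeriv₂Num D g₀ * f₀ ^ 2) = 0 := by
      rw [logDeriv₂Num_mul, logDeriv₂Num_mul] at hN
      linear_combination hN
    exact sub_eq_zero.mp ((mul_eq_zero.mp e).resolve_left (pow_ne_zero _ X_ne_zero))
  have hgi : g₀ * invOfUnit g₀ (Units.mk0 _ hne) = 1 := mul_invOfUnit g₀ _ (Units.val_mk0 _).symm
  set ig := invOfUnit g₀ (Units.mk0 _ hne) with hig
  have hig0 : constantCoeff ig = (constantCoeff g₀)⁻¹ := by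
    rw [hig, constantCoeff_invOfUnit, Units.val_inv_eq_inv_val, Units.val_mk0]
  set q := f₀ * ig with hq
  have hfq : f₀ = q * g₀ := by
    calc f₀ = f₀ * (g₀ * ig) := by rw [hgi, mul_one]
      _ = q * g₀ := by rw [hq]; ring
  have hq0 : constantCoeff q = 1 := by
    rw [hq, map_mul, hig0, h0, mul_inv_cancel₀ hne]
  have hq1 : coeff 1 q = 0 := by
    have e := congrArg (coeff 1) hfq
    rw [coeff_one_mul_eq, coeff_zero_eq_constantCoeff_apply, hq0, one_mul, coeff_zero_eq_constantCoeff_apply,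
      h1] at e
    have e' : coeff 1 q * constantCoeff g₀ = 0 := by linear_combination -e
    exact (mul_eq_zero.mp e').resolve_right hne
  have hNq : logDeriv₂Num D q = 0 := by
    have e : logDeriv₂Num D q * g₀ ^ 4 = 0 := by
      rw [hfq, logDeriv₂Num_mul] at hi
      linear_combination hi
    exact (mul_eq_zero.mp e).resolve_right (pow_ne_zero _ hg0ne)
  have hq1' := eq_one_of_logDeriv₂Num_eq_zero V hq0 hq1 hNq
  rw [hfq, hq1', one_mul]

end Summit.BirchSwinnertonDyer.BirchSwinnertonDyer.Theorems.AlignedTransportAtTwoSigmaSqTwo
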